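import Summits.BirchSwinnertonDyer.BirchSwinnertonDyer.Theses.KatoDescentPotSupersingular
import Summits.BirchSwinnertonDyer.BirchSwinnertonDyer.Theorems.KatoDescentPotSupersingularReducibleKatoMemberOfZetaInputs
import HarnessLib

/-!
# Glue item `ReducibleKatoMemberOfZetaInputs` (K9; ZETA family of crux M `ReducibleKatoMember`, item 19196;
glue item stmt-BirchSwinnertonDyer-20299, rendered by the zeta resplit of 2026-08-27, K9 rev 23)

`PublishedInputNewformKatoZ → PublishedInputMemberHullZetaInputs → PublishedInputRankEqAnalyticRankZ →
ReducibleKatoMember`, closed in one line BY NAME from the landed kernel closer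
`Theorems.reducibleKatoMember_of_memberHullZetaInputs` (bsd-potss-rkm g10, p522483): modularity + Kato's
zeta-only member package (`Kato2004.exists_memberHullZetaInputs`, Thm 12.4 (2)/12.5/13.14) + Gross–Zagier–Kolyvagin
restore `MemberHullInputs` and feed the K9 kernel.  Certified in plan g22's `RKM19196ZetaSplitSketch_v1_1.lean`
(`closes_k9_byName`, rc 0) and by the refuter's attached candidate (evidence #1 on 20299).  Nothing else assumed;
BSD is proved for no curve by this file (the three antecedents are held by-name aliases of named facts in print).
-/

set_option autoImplicit false
set_option linter.dupNamespace false

namespace Summit.BirchSwinnertonDyer.BirchSwinnertonDyer.Theorems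

/-- **Glue item `ReducibleKatoMemberOfZetaInputs` (type = the route decl verbatim).**
[cite: Kato2004Asterisque, Thm. 12.4 (2) (p. 221), Thm. 12.5 (p. 222), 13.14 (p. 234), §14.14 (p. 243)]
[cite: Darmon2004, Thm. 3.22] -/
theorem reducibleKatoMemberOfZetaInputs_proof :
    Summit.BirchSwinnertonDyer.BirchSwinnertonDyer.Theses.KatoDescentPotSupersingular.ReducibleKatoMemberOfZetaInputs :=
  fun hN hZ hG => reducibleKatoMember_of_memberHullZetaInputs hN hZ hG

end Summit.BirchSwinnertonDyer.BirchSwinnertonDyer.Theorems
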